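import Literature.Analysis.InnerProduct.OrbifoldLensSpaceIsospectralTheorem
import Literature.Analysis.InnerProduct.LensSpaceIsospectralRigidityTwoPower
import HarnessLib

/-!
# Isospectral ⟺ isometric for three-dimensional orbifold lens spaces with `|G| = q`: the converse for orbifold weights, and
# Bari–Hunsicker's Theorem 3.1 joined with Ikeda–Yamamoto's Case 1 (`q` a prime power, twice an odd prime power, or `q ≤ 10`)

Layer `Literature/Analysis/InnerProduct`, namespace `Literature.Analysis.InnerProduct`; lane `lit-hodgefound`, prover seat
`lit-hodgefound-p06`, generation 46, row g46-#10. THEOREMS only (no definition, no instance, no notation, no named fact).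
Row g46-#9 proved THEOREM 3.1 of the source for all pairs `L(q : p₁, p₂)`, `L(q : s₁, s₂)` with `|G| = q` that are not both
manifolds (Cases 2–5). This file adds (i) the converse — isometric orbifold lens spaces are isospectral — for weights not
prime to `q` (the tree's `LensWeightsEquivalent.lensSpaceMultiplicity_eq` assumes all weights prime to `q`), and (ii) the
equivalence "isospectral ⟺ isometric" for ALL pairs with `|G| = q` whenever Case 1 (both manifolds: the theorem of Ikeda–Yamamoto
1979 / Yamamoto 1980) is in the tree: `q = l^ν`, `q = 2l^ν` (`l` odd prime), and `q ≤ 10`.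

## Source, verbatim (held text `paper:arxiv-1705.01412`)

N. Bari, E. Hunsicker, *Isospectrality for orbifold lens spaces*, Canad. J. Math. **72** (2020), arXiv:1705.01412. §2.1:
"if we multiply all the `p_i`'s by some number `±l` where `gcd(l, q) = 1`, that simply means we have mapped the generator `g`
to the generator `g^l`, and so we still have the same group `G`. … **Corollary 2.2.** Let `L = L(q : p₁, …, p_n)` and
`L' = L(q : s₁, …, s_n)` be lens spaces. Then `L` is isometric to `L'` if and only if there is a number `l` coprime with `q`
and there are numbers `e_i ∈ {−1, 1}` such that `(p₁, …, p_n)` is a permutation of `(e₁ls₁, …, e_nls_n) (mod q)`. …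
**Proposition 2.10.** … `S^n/G` is isospectral to `S^n/G'` if and only if `F_G(z) = F_{G'}(z)`." §3: "For 3-dimensional
manifold lens spaces, it is known that if two lens spaces are isospectral then they are also isometric ([IY] and [Y]). We
will generalize this result to the orbifold case. … **Theorem 3.1.** Given two 3-dimensional lens spaces `L₁ = L(q: p₁, p₂)`
and `L₂ = L(q: s₁, s₂)`. If `L₁` is isospectral to `L₂`, then the two lens spaces are isometric. Proof. … Case 1 In this case
`L₁` and `L₂` are both manifolds. Ikeda and Yamamoto proved this case (see [IY] and [Y])."

## As formalised

* §1 **`lensMultiplicity_unit_mul`** (`L(q; lp₁, lp₂)`, `l` prime to `q`, has the multiplicities of `L(q; p₁, p₂)`),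
  **`lensMultiplicity_congr_of_modEq_sign_mul`** (weights matter mod `q` and up to sign), and
  **`LensWeightsEquivalent.lensMultiplicity_eq_of_coprime_gcd`**: for `gcd(p₁, p₂, q) = 1`, Ikeda's criterion
  `LensWeightsEquivalent q (p₁, p₂) (s₁, s₂)` (whose multiplier is then prime to `q`, row g46-#9) implies
  `dim E_{n(n+2)}(L(q; p₁, p₂)) = dim E_{n(n+2)}(L(q; s₁, s₂))` for all `n` — isometric ⟹ isospectral.
* §2 **`lensMultiplicity_eq_iff_lensWeightsEquivalent_orbifold_of_prime_pow_or_twice_odd`** and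
  **`lensMultiplicity_eq_iff_lensWeightsEquivalent_orbifold_of_le_ten`**: for `q = l^ν` (`l` prime, `ν ≥ 1`), `q = 2l^ν`
  (`l` odd prime), or `q ≤ 10`, and ALL weight pairs with `|G| = q`: isospectral ⟺ isometric (Case 1 from the tree's
  `lensMultiplicity_eq_iff_lensWeightsEquivalent_of_prime_pow_or_twice_odd` / `_of_le_ten`, Cases 2–5 from row g46-#9).
  For general composite `q` only Case 1 (Yamamoto 1980) is missing.

## References

* [BariHunsicker2019] N. Bari, E. Hunsicker, *Isospectrality for orbifold lens spaces*, Canad. J. Math. 72 (2020)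
  (arXiv:1705.01412), §2.1 Corollary 2.2, Proposition 2.10; §3 Theorem 3.1.
* [IkedaYamamoto1979] A. Ikeda, Y. Yamamoto, *On the spectra of 3-dimensional lens spaces*, Osaka J. Math. 16 (1979) 447–469,
  Main Theorem, Lemma 6.1, Proposition 1.1.
* [Ikeda1980] A. Ikeda, *On lens spaces which are isospectral but not isometric*, Ann. Sci. ÉNS (4) 13 (1980) 303–315,
  Theorem 2.1.
-/

noncomputable section

open Finset

namespace Literature.Analysis.InnerProduct

/-! ### §1 Isometric orbifold lens spaces are isospectral: Ikeda's criterion with a unit multiplier preserves `dim E_{n(n+2)}` -/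

/-- `dim P_k^G` is unchanged by a common unit factor of the weights. [cite: BariHunsicker2019, Corollary 2.2 ("if we multiply
all the `p_i`'s by some number `±l` where `gcd(l, q) = 1` … we still have the same group `G`")] -/
private theorem lensMonomialCount_unit_mul_x10 (q : ℕ) {c : ℤ} (hc : IsCoprime c q) (p₁ p₂ : ℤ) (k : ℕ) :
    lensMonomialCount q (c * p₁) (c * p₂) k = lensMonomialCount q p₁ p₂ k := by
  unfold lensMonomialCount
  refine sum_congr rfl fun ij _ ↦ sum_congr rfl fun ab _ ↦ sum_congr rfl fun cd _ ↦ if_congr ?_ rfl rfl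
  rw [show ((ab.1 : ℤ) - ab.2) * (c * p₁) + ((cd.1 : ℤ) - cd.2) * (c * p₂) =
    c * (((ab.1 : ℤ) - ab.2) * p₁ + ((cd.1 : ℤ) - cd.2) * p₂) by ring]
  exact ⟨fun h ↦ hc.symm.dvd_of_dvd_mul_left h, fun h ↦ dvd_mul_of_dvd_right h _⟩

/-- `L(q; lp₁, lp₂)` and `L(q; p₁, p₂)` have the same multiplicities for `l` prime to `q`. [cite: BariHunsicker2019, Corollary
2.2] -/
theorem lensMultiplicity_unit_mul (q : ℕ) {l : ℤ} (hl : IsCoprime l q) (p₁ p₂ : ℤ) (k : ℕ) :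
    lensMultiplicity q (l * p₁) (l * p₂) k = lensMultiplicity q p₁ p₂ k := by
  simp only [lensMultiplicity, lensMonomialCount_unit_mul_x10 q hl p₁ p₂]

/-- The multiplicities depend on the weights only mod `q` and up to signs. [cite: BariHunsicker2019, Corollary 2.2]
[cite: IkedaYamamoto1979, Proposition 1.1] -/
theorem lensMultiplicity_congr_of_modEq_sign_mul (q : ℕ) {p₁ p₂ p₁' p₂' e₁ e₂ : ℤ} (he₁ : e₁ = 1 ∨ e₁ = -1)
    (he₂ : e₂ = 1 ∨ e₂ = -1) (h₁ : p₁ ≡ e₁ * p₁' [ZMOD q]) (h₂ : p₂ ≡ e₂ * p₂' [ZMOD q]) (k : ℕ) :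
    lensMultiplicity q p₁ p₂ k = lensMultiplicity q p₁' p₂' k := by
  have c₁ : lensMultiplicity q p₁ p₂ k = lensMultiplicity q (e₁ * p₁') p₂ k := by
    rw [lensMultiplicity_swap q p₁, lensMultiplicity_congr_right q p₂ (Int.ModEq.dvd h₁.symm), lensMultiplicity_swap]
  have c₂ : lensMultiplicity q (e₁ * p₁') p₂ k = lensMultiplicity q (e₁ * p₁') (e₂ * p₂') k :=
    lensMultiplicity_congr_right q _ (Int.ModEq.dvd h₂.symm) k
  rw [c₁, c₂]
  have s₂ : lensMultiplicity q (e₁ * p₁') (e₂ * p₂') k = lensMultiplicity q (e₁ * p₁') p₂' k := by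
    rcases he₂ with rfl | rfl
    · rw [one_mul]
    · rw [neg_one_mul, lensMultiplicity_neg_right]
  have s₁ : lensMultiplicity q (e₁ * p₁') p₂' k = lensMultiplicity q p₁' p₂' k := by
    rcases he₁ with rfl | rfl
    · rw [one_mul]
    · rw [neg_one_mul, lensMultiplicity_swap, lensMultiplicity_neg_right, lensMultiplicity_swap]
  rw [s₂, s₁]

/-- **ISOMETRIC ⟹ ISOSPECTRAL for three-dimensional orbifold lens spaces with `|G| = q`**: if `(p₁, p₂)` is a permutation of
`(e₁ls₁, e₂ls₂) (mod q)` (Ikeda's criterion; for `gcd(p₁, p₂, q) = 1` the multiplier `l` is prime to `q`) then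
`dim E_{n(n+2)}(L(q; p₁, p₂)) = dim E_{n(n+2)}(L(q; s₁, s₂))` for all `n` — the two weight pairs generate the same cyclic
group up to conjugation in `O(4)`. (The tree's `LensWeightsEquivalent.lensSpaceMultiplicity_eq` assumes all weights prime to
`q`.) [cite: BariHunsicker2019, Corollary 2.2, Proposition 2.10] [cite: Ikeda1980, Theorem 2.1] -/
theorem LensWeightsEquivalent.lensMultiplicity_eq_of_coprime_gcd {q : ℕ} {p₁ p₂ s₁ s₂ : ℤ}
    (h : LensWeightsEquivalent q ![p₁, p₂] ![s₁, s₂]) (hp : (Int.gcd p₁ p₂).Coprime q) (k : ℕ) :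
    lensMultiplicity q p₁ p₂ k = lensMultiplicity q s₁ s₂ k := by
  obtain ⟨l, hl, e, he, σ, hσ⟩ := h.exists_isCoprime_of_coprime_gcd hp
  have hfin : ∀ i : Fin 2, i = 0 ∨ i = 1 := by decide
  have h0 := hσ 0
  have h1 := hσ 1
  rcases hfin (σ 0) with hσ0 | hσ0
  · have hσ1 : σ 1 = 1 := by
      rcases hfin (σ 1) with h' | h'
      · exact absurd (σ.injective (h'.trans hσ0.symm)) (by decide)
      · exact h'
    rw [hσ0] at h0
    rw [hσ1] at h1
    simp only [Matrix.cons_val_zero, Matrix.cons_val_one] at h0 h1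
    rw [lensMultiplicity_congr_of_modEq_sign_mul q (he 0) (he 1) (p₁' := l * s₁) (p₂' := l * s₂)
      (by rw [← mul_assoc]; exact h0) (by rw [← mul_assoc]; exact h1), lensMultiplicity_unit_mul q hl]
  · have hσ1 : σ 1 = 0 := by
      rcases hfin (σ 1) with h' | h'
      · exact h'
      · exact absurd (σ.injective (h'.trans hσ0.symm)) (by decide)
    rw [hσ0] at h0
    rw [hσ1] at h1
    simp only [Matrix.cons_val_zero, Matrix.cons_val_one] at h0 h1
    rw [lensMultiplicity_congr_of_modEq_sign_mul q (he 1) (he 0) (p₁' := l * s₂) (p₂' := l * s₁)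
      (by rw [← mul_assoc]; exact h1) (by rw [← mul_assoc]; exact h0), lensMultiplicity_unit_mul q hl,
      lensMultiplicity_swap]

/-! ### §2 THEOREM 3.1 with Case 1: isospectral ⟺ isometric for `q` a prime power, twice an odd prime power, or `q ≤ 10` -/

/-- **THEOREM 3.1 (Bari–Hunsicker 2019) ∧ MAIN THEOREM (Ikeda–Yamamoto 1979), `q = l^ν` or `q = 2l^ν` (`l` odd):** for ALL
pairs of three-dimensional orbifold lens spaces `L(q : p₁, p₂)`, `L(q : s₁, s₂)` with `|G| = q` (`gcd(p₁, p₂, q) = 1 =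
gcd(s₁, s₂, q)`) — manifolds or not — ISOSPECTRAL ⟺ ISOMETRIC (Ikeda's criterion = Corollary 2.2): Case 1 (both manifolds)
is the tree's `lensMultiplicity_eq_iff_lensWeightsEquivalent_of_prime_pow_or_twice_odd` (Ikeda–Yamamoto's theorem as proved in
[IkedaYamamoto1979] for these `q`), Cases 2–5 are `lensWeightsEquivalent_of_lensMultiplicity_eq_of_not_manifolds`; the
converse is `LensWeightsEquivalent.lensMultiplicity_eq_of_coprime_gcd`. [cite: BariHunsicker2019, Theorem 3.1, Corollary
2.2] [cite: IkedaYamamoto1979, Main Theorem] -/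
theorem lensMultiplicity_eq_iff_lensWeightsEquivalent_orbifold_of_prime_pow_or_twice_odd {q l ν : ℕ} (hl : l.Prime)
    (hν : ν ≠ 0) (hq : q = l ^ ν ∨ (l ≠ 2 ∧ q = 2 * l ^ ν)) {p₁ p₂ s₁ s₂ : ℤ} (hp : (Int.gcd p₁ p₂).Coprime q)
    (hs : (Int.gcd s₁ s₂).Coprime q) :
    (∀ n : ℕ, lensMultiplicity q p₁ p₂ n = lensMultiplicity q s₁ s₂ n) ↔ LensWeightsEquivalent q ![p₁, p₂] ![s₁, s₂] := by
  have hq0 : q ≠ 0 := by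
    rcases hq with hq | ⟨-, hq⟩ <;> rw [hq]
    · exact pow_ne_zero _ hl.ne_zero
    · exact mul_ne_zero two_ne_zero (pow_ne_zero _ hl.ne_zero)
  haveI : NeZero q := ⟨hq0⟩
  refine ⟨fun h ↦ ?_, fun h n ↦ h.lensMultiplicity_eq_of_coprime_gcd hp n⟩
  by_cases h1 : IsCoprime p₁ q ∧ IsCoprime p₂ q ∧ IsCoprime s₁ q ∧ IsCoprime s₂ q
  · exact (lensMultiplicity_eq_iff_lensWeightsEquivalent_of_prime_pow_or_twice_odd hl hν hq h1.1 h1.2.1 h1.2.2.1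
      h1.2.2.2).mp h
  · exact lensWeightsEquivalent_of_lensMultiplicity_eq_of_not_manifolds hp hs h1 h

/-- **… and for `q ≤ 10`** (Case 1 = Ikeda–Yamamoto's Lemma 6.1, the tree's `lensMultiplicity_eq_iff_lensWeightsEquivalent_of_le_ten`).
[cite: BariHunsicker2019, Theorem 3.1, Corollary 2.2] [cite: IkedaYamamoto1979, Lemma 6.1] -/
theorem lensMultiplicity_eq_iff_lensWeightsEquivalent_orbifold_of_le_ten {q : ℕ} [NeZero q] (hq : q ≤ 10) {p₁ p₂ s₁ s₂ : ℤ}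
    (hp : (Int.gcd p₁ p₂).Coprime q) (hs : (Int.gcd s₁ s₂).Coprime q) :
    (∀ n : ℕ, lensMultiplicity q p₁ p₂ n = lensMultiplicity q s₁ s₂ n) ↔ LensWeightsEquivalent q ![p₁, p₂] ![s₁, s₂] := by
  refine ⟨fun h ↦ ?_, fun h n ↦ h.lensMultiplicity_eq_of_coprime_gcd hp n⟩
  by_cases h1 : IsCoprime p₁ q ∧ IsCoprime p₂ q ∧ IsCoprime s₁ q ∧ IsCoprime s₂ q
  · exact (lensMultiplicity_eq_iff_lensWeightsEquivalent_of_le_ten (NeZero.ne q) hq h1.1 h1.2.1 h1.2.2.1 h1.2.2.2).mp h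
  · exact lensWeightsEquivalent_of_lensMultiplicity_eq_of_not_manifolds hp hs h1 h

end Literature.Analysis.InnerProduct
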